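/-
Origin: expansion seat `planner-pub-hodgecm-pv09-g6-0`, handover #4 2026-08-18T11:53:11Z (`HOME/pub-hodgecm-pv09-g6/lean/Pv09g6/GenuineTensorEnd.lean`, md5 0182baea, 223 lines);
landed by the gen-8 packager in gate run 29 as `HodgeCM/PerL34/GenuineTensorEnd.lean` (import ^import Pv09g6\.GenuineTensorInput[ \t]*$→import HodgeCM.PerL34.GenuineTensorInput ×1).
-/
/-
Copyright: HodgeCM publication cell (pub-hodgecm), seam S3 (𝓕-side / genuine idelic torus end; the S3 END
specialised to the restricted-tensor-product model).  Prover seat pub-hodgecm-pv09-g6 (DAG-node prover #09,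
generation 6), file #4 (HANDOVER #4); intended final place `HodgeCM/PerL34/GenuineTensorEnd.lean`.  WIP import:
`Pv09g6.GenuineTensorInput` ↦ `HodgeCM.PerL34.GenuineTensorInput` (this seat, HANDOVER #3).  Complete proofs,
no new axioms, nothing cited.  Released under the package licence.
-/
import Summits.HodgeConjecture.HodgeCM.PerL34.GenuineTensorInput

/-!
# The S3 END with the torus side discharged by the `⊗′`-model

`HodgeCM.PerL34.PureTensor.exists_compactDomain_thetaLift_ne_zero_genuine_of_input` (tree, `GenuineThetaInput`)
is the S3 headline for the genuine torus `U(1)_{L/L⁺}` from ONE named representation-side input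
`X : GenuineThetaInput L S Sp D.ω φ χ` plus the `(ω, φ)`-hypotheses `hφ, hloc, hK, hM`.  Files #1–#3 of this seat
(`RestrictedTensor`, `GenuineTensorModel`, `GenuineTensorInput`) construct, for EVERY CM field `L`, finite `S`,
character `χ` (level `K_{T'}`, `T' ⊆ S`, local continuity on `T'`) and every family of continuous unitary
characters `ν_i` unramified at the split places off `S` with centres `x₀_i ≠ 0` at the split places of `S`,
the space `Sp := ⊗′_i (H_i, e_i) = RestrictedTensor.Space (unitFam L)`, the representation
`⊗′ρ = RestrictedTensor.rep (admissible L hν hχT')`, the unit vector `φ• = phi L S x₀ (radius …)` and an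
inhabitant of `GenuineThetaInput`, with `hφ, hloc, hK, hM` as theorems.

This file records the consequence at the END: **for any doubling datum `D` on `Sp = ⊗′H` whose representation
`D.ω` IS `⊗′ρ`** (hypothesis `hω`; the END's theta-side data, print inputs and the character-side hypotheses
unchanged), the END's conclusion holds for `φ•` with NO representation-side hypothesis left
(`exists_compactDomain_thetaLift_ne_zero_genuine_tensor`), and with the bookkeeping `S ⊇ T' ∪ {∞}` removed by
the choice `S := levelSet L T'` (`…_tensor_level`).  It is the `⊗′`-side twin of pv07-g4's
`SchrodingerModel.Coeff.exists_compactDomain_thetaLift_ne_zero_genuine_shift(_level)` (concrete `L²(X)` model,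
`ν` tied to `χ`); here `ν` and the centres are free.

Honest limits: the binders that remain are exactly the ambient-model ones (`D` with `hω`, `GU`, `j, hj`, `P`,
`hχVΓ`, finiteness of `GU.μ`) and the character-side ones (`hχΓ, hχT', hlocχ`); nothing is cited; no PRINT item.
-/

set_option autoImplicit false

noncomputable section

open MeasureTheory MeasureTheory.Measure Set Metric Function Complex ComplexConjugate Topology Filter
open scoped RestrictedProduct InnerProductSpace NNReal ENNReal

namespace HodgeCM.PerL34.RestrictedTensor.Genuine

open HodgeCM.PerL34.SplitShells HodgeCM.PerL34.AdelicFactorisation HodgeCM.PerL34.RestrictedMeasure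
open HodgeCM.PerL34.NoSmallSubgroups HodgeCM.PerL34.EulerFactorisation HodgeCM.PerL34.DiscreteFD
open HodgeCM.PerL34.LocalFactors HodgeCM.PerL34.LocalFactors.DilationModel
open HodgeCM.PerL34.LocalModulus HodgeCM.PerL34.SplitPlaceDilation
open HodgeCM.PerL34.RallisIP HodgeCM.PerL34.Doubling HodgeCM.PerL34.N31d NumberField IsDedekindDomain
open HodgeCM.PerL34.IdelePlaces HodgeCM.PerL34.RestrictedRegroup HodgeCM.PerL34.RestrictedCutout
open HodgeCM.PerL34.IdelicTorusModel HodgeCM.PerL34.IdelicTorusModel.Genuine HodgeCM.PerL34.PureTensor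

attribute [local instance] LocalFactors.DilationModel.Adic.nontriviallyNormedField
  LocalFactors.DilationModel.Adic.properSpace

variable (L : Type) [Field L] [NumberField L] [IsCMField L]

set_option synthInstance.maxHeartbeats 200000 in
-- (as in the END theorem: the `SMul Γ (Model L)` instance behind `IsFundamentalDomain` is slow to find)
/-- **S3 END with the torus side discharged by the restricted tensor product `⊗′_i (H_i, e_i)`.**  For a CM
field `L`, a finite set `S` of places of `L⁺` containing `T'` and the infinite places, a character `χ` of the
model group of level `K_{T'}` (locally continuous on `T'`, trivial on `U(1)(L⁺)`), ANY family `ν_i` of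
continuous unitary characters unramified at the split places off `S`, ANY centres `x₀_i ≠ 0` at the split
places of `S`, and ANY doubling datum `D` on `Sp = ⊗′H` with `D.ω = ⊗′ρ` (+ the END's theta-side data and print
inputs, unchanged): the END's conclusion for `φ• = phi L S x₀ (radius …)`, with no representation-side
hypothesis left. -/
theorem exists_compactDomain_thetaLift_ne_zero_genuine_tensor [DecidableEq (Place (maximalRealSubfield L))]
    [∀ v : HeightOneSpectrum (𝓞 (maximalRealSubfield L)), MeasurableSpace (v.adicCompletion (maximalRealSubfield L))]
    [∀ v : HeightOneSpectrum (𝓞 (maximalRealSubfield L)), BorelSpace (v.adicCompletion (maximalRealSubfield L))]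
    (S₀ : Finset (Place (maximalRealSubfield L)))
    {W : Type} [AddCommGroup W] [Module L W]
    {H Sbox : Type} [Group H] [AddCommGroup Sbox] [Module ℂ Sbox]
    {h : W →ₗ⋆[L] W →ₗ[L] L} (hW : IsLine L W) (hh : Anisotropic h)
    (D : DoublingDatum (Model L) H (Space (unitFam L)) Sbox) (GU : ThetaSide (Space (unitFam L)) Sbox)
    (j : isomBox h →* H) (hj : ∀ d : unitary L, j ⟨iotaSnd d, iotaSnd_mem h d⟩ = D.ι (1, unitaryToModel L d))
    (χ : Model L →* Circle) (hχΓ : ∀ d : unitary L, χ (unitaryToModel L d) = 1)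
    (hχVΓ : ∀ d : unitary L, D.χV (unitaryToModel L d) = 1)
    {hP : ∀ Ψ : Sbox, ∀ p ∈ (stabDelta L W).subgroupOf (isomBox h), ∀ x : H, D.fSW Ψ (j p * x) = D.fSW Ψ x}
    (P : GluePrintInputs D GU h j hP)
    {T' : Finset (Place (maximalRealSubfield L))}
    (hχT' : RestrictedProduct.boxSubgroup (genLevel L) T' ≤ χ.ker)
    (hlocχ : ∀ i ∈ T', Continuous fun g : locTorus (maximalRealSubfield L) L i =>
      χ (RestrictedProduct.mulSingle (genLevel L) i g))
    {S : Finset (Place (maximalRealSubfield L))} (hT'S : T' ⊆ S)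
    (hS : ∀ v : InfinitePlace (maximalRealSubfield L), Sum.inl v ∈ S)
    {ν : ∀ i : Place (maximalRealSubfield L),
      ((basePlaceOf L i).adicCompletion (maximalRealSubfield L))ˣ →* Circle}
    (hν : ∀ i, i ∉ S → IsSplitPlace L i →
      ∀ u : ((basePlaceOf L i).adicCompletion (maximalRealSubfield L))ˣ,
        ‖(u : (basePlaceOf L i).adicCompletion (maximalRealSubfield L))‖ = 1 → ν i u = 1)
    (hνc : ∀ i, IsSplitPlace L i → Continuous (ν i))
    (x₀ : ∀ i : Place (maximalRealSubfield L), Fin 3 → (basePlaceOf L i).adicCompletion (maximalRealSubfield L))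
    (hx₀ : ∀ i ∈ S, IsSplitPlace L i → x₀ i ≠ 0)
    (hω : D.ω = rep (admissible L hν hχT')) [IsFiniteMeasure GU.μ] :
    ∃ 𝓕 : Set (Model L), IsCompact 𝓕 ∧ (interior 𝓕).Nonempty ∧ MeasurableSet 𝓕 ∧
      IsFundamentalDomain (unitaryToModel L).range 𝓕
        (haarDatum (genLevel L) (isCompact_genLevel L) (isOpen_genLevel L) S₀).μ ∧
      (haarDatum (genLevel L) (isCompact_genLevel L) (isOpen_genLevel L) S₀).μ 𝓕 ≠ 0 ∧
      (haarDatum (genLevel L) (isCompact_genLevel L) (isOpen_genLevel L) S₀).μ 𝓕 ≠ ⊤ ∧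
      ∀ [IsFiniteMeasure (((haarDatum (genLevel L) (isCompact_genLevel L) (isOpen_genLevel L) S₀).μ).restrict 𝓕)]
        (hk : Measurable (Function.uncurry
          (thetaFn D GU (phi L S x₀ (radius L S hνc hχT' hlocχ x₀ hx₀))))) {Ck : ℝ} (hCk : 0 ≤ Ck)
        (hkC : ∀ q u, ‖thetaFn D GU (phi L S x₀ (radius L S hνc hχT' hlocχ x₀ hx₀)) q u‖ ≤ Ck),
        PeterssonFubini.theta GU.μ
          (((haarDatum (genLevel L) (isCompact_genLevel L) (isOpen_genLevel L) S₀).μ).restrict 𝓕) hk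
          (measurable_coe_char (genLevel L) (isOpen_genLevel L) χ hχT' hlocχ) hCk hkC (norm_coe_char_le χ) ≠ 0 := by
  have hr0 : ∀ i ∈ S, IsSplitPlace L i → 0 < radius L S hνc hχT' hlocχ x₀ hx₀ i :=
    fun i hi hs => (radius_spec L S hνc hχT' hlocχ x₀ hx₀ i hi hs).1
  have hloc' : ∀ (i : Place (maximalRealSubfield L)) (v : Space (unitFam L)),
      Continuous fun g : locTorus (maximalRealSubfield L) L i =>
        D.ω (RestrictedProduct.mulSingle (genLevel L) i g) v := by
    rw [hω]; exact fun i v => continuous_rep_mulSingle_apply L S hν hχT' hνc hlocχ i v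
  have hK' : ∀ k ∈ RestrictedProduct.boxSubgroup (genLevel L) (S ∪ T'),
      D.ω k (phi L S x₀ (radius L S hνc hχT' hlocχ x₀ hx₀)) = phi L S x₀ (radius L S hνc hχT' hlocχ x₀ hx₀) := by
    rw [hω]; exact fun k hk => rep_phi_eq_self L S x₀ _ hν hχT' hk
  have hM' : ∀ S' : Finset (Place (maximalRealSubfield L)), S ∪ T' ⊆ S' →
      ∀ y : (i : ↥S') → locTorus (maximalRealSubfield L) L i,
        inner ℂ (phi L S x₀ (radius L S hνc hχT' hlocχ x₀ hx₀))
            (D.ω (extendOne (genLevel L) S' y) (phi L S x₀ (radius L S hνc hχT' hlocχ x₀ hx₀))) =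
          ∏ i : ↥S', localCoeff (genLevel L) D.ω (phi L S x₀ (radius L S hνc hχT' hlocχ x₀ hx₀)) i (y i) := by
    rw [hω]; exact fun S' _ y => inner_phi_rep_extendOne L S x₀ hν hχT' hr0 S' y
  have X' : GenuineThetaInput L S (Space (unitFam L)) D.ω (phi L S x₀ (radius L S hνc hχT' hlocχ x₀ hx₀)) χ := by
    rw [hω]; exact thetaInputOfData L S hν hνc hχT' hlocχ x₀ hx₀
  exact exists_compactDomain_thetaLift_ne_zero_genuine_of_input L S₀ hW hh D GU j hj χ hχΓ hχVΓ P
    (phi L S x₀ (radius L S hνc hχT' hlocχ x₀ hx₀)) (norm_phi L S x₀ hr0) hloc' hχT' hlocχ hK' hM'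
    (Finset.union_subset subset_rfl hT'S) hT'S hS X'

/-! ## The bookkeeping removed: `S := T' ∪ {infinite places}` -/

/-- the finite set of places attached to a level `T'`: `T'` together with all infinite places. -/
def levelSet [DecidableEq (Place (maximalRealSubfield L))] (T' : Finset (Place (maximalRealSubfield L))) :
    Finset (Place (maximalRealSubfield L)) :=
  T' ∪ (Finset.univ : Finset (InfinitePlace (maximalRealSubfield L))).image Sum.inl

omit [IsCMField L] in
/-- (Ported verbatim from the HodgeCMPerL package; no docstring in the source.) -/
theorem subset_levelSet [DecidableEq (Place (maximalRealSubfield L))]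
    (T' : Finset (Place (maximalRealSubfield L))) : T' ⊆ levelSet L T' :=
  Finset.subset_union_left

omit [IsCMField L] in
/-- (Ported verbatim from the HodgeCMPerL package; no docstring in the source.) -/
theorem inl_mem_levelSet [DecidableEq (Place (maximalRealSubfield L))]
    (T' : Finset (Place (maximalRealSubfield L))) (v : InfinitePlace (maximalRealSubfield L)) :
    (Sum.inl v : Place (maximalRealSubfield L)) ∈ levelSet L T' :=
  Finset.mem_union_right _ (Finset.mem_image_of_mem _ (Finset.mem_univ v))

/-- at an infinite index there is nothing to choose: such indices are never split. -/
theorem not_isSplitPlace_inl (v : InfinitePlace (maximalRealSubfield L)) :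
    ¬ IsSplitPlace L (Sum.inl v : Place (maximalRealSubfield L)) :=
  fun hs => by cases hs

/-- "unramified at the split places off `T'`" implies the same off `levelSet L T'`. -/
theorem unram_levelSet [DecidableEq (Place (maximalRealSubfield L))] {T' : Finset (Place (maximalRealSubfield L))}
    {ν : ∀ i : Place (maximalRealSubfield L),
      ((basePlaceOf L i).adicCompletion (maximalRealSubfield L))ˣ →* Circle}
    (hν : ∀ i, i ∉ T' → IsSplitPlace L i →
      ∀ u : ((basePlaceOf L i).adicCompletion (maximalRealSubfield L))ˣ,
        ‖(u : (basePlaceOf L i).adicCompletion (maximalRealSubfield L))‖ = 1 → ν i u = 1) :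
    ∀ i, i ∉ levelSet L T' → IsSplitPlace L i →
      ∀ u : ((basePlaceOf L i).adicCompletion (maximalRealSubfield L))ˣ,
        ‖(u : (basePlaceOf L i).adicCompletion (maximalRealSubfield L))‖ = 1 → ν i u = 1 :=
  fun i hi hs u hu => hν i (fun hiT => hi (subset_levelSet L T' hiT)) hs u hu

/-- centres nonzero at the split places of `T'` are nonzero at the split places of `levelSet L T'`. -/
theorem centre_levelSet [DecidableEq (Place (maximalRealSubfield L))] {T' : Finset (Place (maximalRealSubfield L))}
    {x₀ : ∀ i : Place (maximalRealSubfield L), Fin 3 → (basePlaceOf L i).adicCompletion (maximalRealSubfield L)}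
    (hx₀ : ∀ i ∈ T', IsSplitPlace L i → x₀ i ≠ 0) :
    ∀ i ∈ levelSet L T', IsSplitPlace L i → x₀ i ≠ 0 := by
  intro i hi hs
  rcases Finset.mem_union.1 hi with hiT | hinf
  · exact hx₀ i hiT hs
  · obtain ⟨v, -, rfl⟩ := Finset.mem_image.1 hinf
    exact absurd hs (not_isSplitPlace_inl L v)

set_option synthInstance.maxHeartbeats 200000 in
/-- **The same with `S := levelSet L T'`.**  Binders = the END's theta/doubling side, the character
(`χ, hχΓ, hχT', hlocχ`), the free local data `ν` (unramified at the split places off `T'`, continuous at the split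
places) and centres `x₀ ≠ 0` at the split places of `T'`, and `hω`. -/
theorem exists_compactDomain_thetaLift_ne_zero_genuine_tensor_level [DecidableEq (Place (maximalRealSubfield L))]
    [∀ v : HeightOneSpectrum (𝓞 (maximalRealSubfield L)), MeasurableSpace (v.adicCompletion (maximalRealSubfield L))]
    [∀ v : HeightOneSpectrum (𝓞 (maximalRealSubfield L)), BorelSpace (v.adicCompletion (maximalRealSubfield L))]
    (S₀ : Finset (Place (maximalRealSubfield L)))
    {W : Type} [AddCommGroup W] [Module L W]
    {H Sbox : Type} [Group H] [AddCommGroup Sbox] [Module ℂ Sbox]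
    {h : W →ₗ⋆[L] W →ₗ[L] L} (hW : IsLine L W) (hh : Anisotropic h)
    (D : DoublingDatum (Model L) H (Space (unitFam L)) Sbox) (GU : ThetaSide (Space (unitFam L)) Sbox)
    (j : isomBox h →* H) (hj : ∀ d : unitary L, j ⟨iotaSnd d, iotaSnd_mem h d⟩ = D.ι (1, unitaryToModel L d))
    (χ : Model L →* Circle) (hχΓ : ∀ d : unitary L, χ (unitaryToModel L d) = 1)
    (hχVΓ : ∀ d : unitary L, D.χV (unitaryToModel L d) = 1)
    {hP : ∀ Ψ : Sbox, ∀ p ∈ (stabDelta L W).subgroupOf (isomBox h), ∀ x : H, D.fSW Ψ (j p * x) = D.fSW Ψ x}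
    (P : GluePrintInputs D GU h j hP)
    {T' : Finset (Place (maximalRealSubfield L))}
    (hχT' : RestrictedProduct.boxSubgroup (genLevel L) T' ≤ χ.ker)
    (hlocχ : ∀ i ∈ T', Continuous fun g : locTorus (maximalRealSubfield L) L i =>
      χ (RestrictedProduct.mulSingle (genLevel L) i g))
    {ν : ∀ i : Place (maximalRealSubfield L),
      ((basePlaceOf L i).adicCompletion (maximalRealSubfield L))ˣ →* Circle}
    (hν : ∀ i, i ∉ T' → IsSplitPlace L i →
      ∀ u : ((basePlaceOf L i).adicCompletion (maximalRealSubfield L))ˣ,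
        ‖(u : (basePlaceOf L i).adicCompletion (maximalRealSubfield L))‖ = 1 → ν i u = 1)
    (hνc : ∀ i, IsSplitPlace L i → Continuous (ν i))
    (x₀ : ∀ i : Place (maximalRealSubfield L), Fin 3 → (basePlaceOf L i).adicCompletion (maximalRealSubfield L))
    (hx₀ : ∀ i ∈ T', IsSplitPlace L i → x₀ i ≠ 0)
    (hω : D.ω = rep (admissible L (unram_levelSet L hν) hχT'))
    [IsFiniteMeasure GU.μ] :
    ∃ 𝓕 : Set (Model L), IsCompact 𝓕 ∧ (interior 𝓕).Nonempty ∧ MeasurableSet 𝓕 ∧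
      IsFundamentalDomain (unitaryToModel L).range 𝓕
        (haarDatum (genLevel L) (isCompact_genLevel L) (isOpen_genLevel L) S₀).μ ∧
      (haarDatum (genLevel L) (isCompact_genLevel L) (isOpen_genLevel L) S₀).μ 𝓕 ≠ 0 ∧
      (haarDatum (genLevel L) (isCompact_genLevel L) (isOpen_genLevel L) S₀).μ 𝓕 ≠ ⊤ ∧
      ∀ [IsFiniteMeasure (((haarDatum (genLevel L) (isCompact_genLevel L) (isOpen_genLevel L) S₀).μ).restrict 𝓕)]
        (hk : Measurable (Function.uncurry
          (thetaFn D GU (phi L (levelSet L T') x₀ (radius L (levelSet L T') hνc hχT' hlocχ x₀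
            (centre_levelSet L hx₀)))))) {Ck : ℝ} (hCk : 0 ≤ Ck)
        (hkC : ∀ q u, ‖thetaFn D GU (phi L (levelSet L T') x₀ (radius L (levelSet L T') hνc hχT' hlocχ x₀
            (centre_levelSet L hx₀))) q u‖ ≤ Ck),
        PeterssonFubini.theta GU.μ
          (((haarDatum (genLevel L) (isCompact_genLevel L) (isOpen_genLevel L) S₀).μ).restrict 𝓕) hk
          (measurable_coe_char (genLevel L) (isOpen_genLevel L) χ hχT' hlocχ) hCk hkC (norm_coe_char_le χ) ≠ 0 :=
  exists_compactDomain_thetaLift_ne_zero_genuine_tensor L S₀ hW hh D GU j hj χ hχΓ hχVΓ P hχT' hlocχ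
    (subset_levelSet L T') (inl_mem_levelSet L T') (unram_levelSet L hν) hνc x₀ (centre_levelSet L hx₀) hω

end HodgeCM.PerL34.RestrictedTensor.Genuine

end
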